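import Summits.QuantumFields.YangMills.Theses.FemtoCutoffLadder
import Summits.QuantumFields.YangMills.Theorems.FemtoCutoffLadderUpStepEvGlue
import Summits.QuantumFields.YangMills.Theorems.FemtoCutoffLadderLocalWallGlue
import Summits.QuantumFields.YangMills.Theorems.FemtoCutoffLadderLocalWallReductions
import Summits.QuantumFields.YangMills.Theorems.FemtoCutoffLadderLargeFieldInsensitivityRReductions
import Summits.QuantumFields.YangMills.Theorems.FemtoCutoffLadderCoarsePairScalingGlue
import Summits.QuantumFields.YangMills.Theorems.FemtoCutoffLadderOneSiteGapUpper
import Summits.QuantumFields.YangMills.Theorems.FemtoCutoffLadderOneSiteWindowAnchor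
import Summits.QuantumFields.YangMills.Theorems.FemtoCutoffLadderMatchedCouplingExists

/-!
# Route `FemtoCutoffLadder` rev 24 — the R2b1 leaf from EXACTLY the four open analytic texts of the cone (state-of-the-route certificate)

Lead seat `ym-line-fcl-p1` g9 (2026-08-28).  After the closes switch of rev 24 (`closes : OctaveStepDecay → UpStepEv → CoarsePairScaling →
OneSiteWindowAnchor → MatchedCouplingExists → Assembly3 → FemtoGapOfRecord`, planner ym-idea-1 g5; `Assembly3` PROVED) and the registered
skeletons of record (lead g9), every proved seam of the route composes into ONE kernel-checked implication: the RECORD-rung leaf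
`FemtoGapOfRecord` follows from

  (A) `SmallFieldOctaveStep` (stmt-QuantumFields-25695) — the one-tower octave step for the SF_κ-compressed min–max values;
  (W) the two COMPARISON clauses of `LocalWallStep` (stmt-QuantumFields-26282), uniform in the wall set — spelled out;
  (P) `PinnedUpStep` (stmt-QuantumFields-26925) — the pinned, de-aliased upward incommensurable engine (seat ym-line-fcl-p3);
  (F) `FixedLatticeLaw` (stmt-QuantumFields-23943) — the fixed-lattice Lüscher law with rate (pooled with route RED's lane A),

and NOTHING else: ★ `femtoGapOfRecord_of_four`.  Chain: (W) ⟹ `LocalWallStep` (`localWallStep_of_comparisons`, p616201; positivity free,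
p615421) ⟹ `LargeFieldInsensitivityR` (`largeFieldInsensitivityR_of_localWallStep`, planner p610789) ⟹ with (A): `OctaveStepDecay`
(`octaveStepDecay_of_smallField_of_largeFieldInsensitivityR`, p611095 ∘ lead-g8 p606919); (P) ⟹ `UpStepEv` (`upStepEv_of_pinnedUpStep`, p616170);
(F) ⟹ `CoarsePairScaling` (`coarsePairScalingGlue_proof` + `oneSiteGapUpper_proof`); anchor and matching proved; `assembly3_proof`.
HONEST FRAMING: a composition of landed glue — none of (A), (W), (P), (F) is proved here or anywhere; all four are OPEN and (A), (W), (P) sit behind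
`Literature.Barriers.QuantumFields.UVStabilityNonUniqueness`.  R2b1 is a RECORD rung — not infinite volume, not a mass gap, not Clay; no summit is
proved by this line.  No definitions, no named facts, no `sorry`.
-/

set_option autoImplicit false

noncomputable section

namespace Summit.QuantumFields.YangMills.Theorems.FemtoCutoffLadder

open Literature.MathematicalPhysics.QuantumFieldTheory hiding SU2
open Summit.QuantumFields.YangMills.Theorems.FemtoTransferGap
open Summit.QuantumFields.YangMills.Theses.FemtoCutoffLadder

/-- ★ **The leaf from the four open texts of the rev-24 cone.**  `SmallFieldOctaveStep` (25695), the comparison clauses of `LocalWallStep`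
(26282, spelled), `PinnedUpStep` (26925) and `FixedLatticeLaw` (23943) imply `FemtoGapOfRecord` — every other seam of route
`FemtoCutoffLadder` is proved in the tree. [cite: LuscherWeiszWolff1991] [cite: Luscher1983, §3] -/
theorem femtoGapOfRecord_of_four (hA : SmallFieldOctaveStep)
    (hW : ∀ κ : ℝ, 0 < κ → κ < 1 → ∃ (A lam0 : ℝ) (L0 : ℕ), 0 ≤ A ∧ 0 < lam0 ∧ ∀ lam : ℝ, 0 < lam → lam ≤ lam0 → ∀ (L : ℕ) [NeZero L], L0 ≤ L → ∀ β : ℝ, InFemtoWindow lam β L → let W : Set (Plaquette 3 L) → (GaugeConfig 3 L SU2 → ℝ) → Prop := fun Q ψ => ∀ U, (∃ p ∈ Q, β ^ (κ - 1) < 2 - (su2Rep (plaquetteHolonomy U p.1 p.2.1.1 p.2.1.2)).trace.re) → ψ U = 0; let t : Set (Plaquette 3 L) → ℝ := fun Q => sSup (rayleighSet su2Rep L β (W Q)); let s : Set (Plaquette 3 L) → ℝ := fun Q => sInf {x : ℝ | ∃ φ : GaugeConfig 3 L SU2 → ℝ, IsPhys φ ∧ x = sSup (rayleighSet su2Rep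 L β fun ψ => W Q ψ ∧ l2 ψ φ = 0)}; ∀ (Q : Set (Plaquette 3 L)) (p₀ : Plaquette 3 L), p₀ ∉ Q → s (insert p₀ Q) ^ L * t Q ^ L ≤ Real.exp (A / β ^ 2 / (Fintype.card (Plaquette 3 L) : ℝ)) * (s Q ^ L * t (insert p₀ Q) ^ L) ∧ s Q ^ L * t (insert p₀ Q) ^ L ≤ Real.exp (A / β ^ 2 / (Fintype.card (Plaquette 3 L) : ℝ)) * (s (insert p₀ Q) ^ L * t Q ^ L))
    (hP : PinnedUpStep) (hF : FixedLatticeLaw) : FemtoGapOfRecord :=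
  assembly3_proof
    (octaveStepDecay_of_smallField_of_largeFieldInsensitivityR hA
      (largeFieldInsensitivityR_of_localWallStep (localWallStep_of_comparisons hW)))
    (upStepEv_of_pinnedUpStep hP)
    (coarsePairScalingGlue_proof hF oneSiteGapUpper_proof)
    oneSiteWindowAnchor_proof matchedCouplingExists_proof

end Summit.QuantumFields.YangMills.Theorems.FemtoCutoffLadder

end
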